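import Summits.BirchSwinnertonDyer.BirchSwinnertonDyer.Theorems.GenusKolyvaginAtTwoEquivariantKolyvaginExactAtTwoDualityRat
import Summits.BirchSwinnertonDyer.BirchSwinnertonDyer.Theorems.GenusKolyvaginAtTwoEquivariantKolyvaginExactAtTwoLocalTorsionCount
import HarnessLib

/-!
# Route ByReductionTypeAtTwo, crux `RankOneAtTwoBigImageOddLocal` (stmt-BirchSwinnertonDyer-23715), LINE v8.8 `one_door_analytic`:
# the RECIPROCITY LEAF `hrec` of the bottom rung — Poitou–Tate with ONE ERROR PLACE and Tate local duality at a Kolyvagin prime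

Width prover seat `bsd-line-fkl-p2` g10 (2026-08-28), `--supports stmt-BirchSwinnertonDyer-23715` (helper).  THEOREMS ONLY (no
definition, no named fact, no `sorry`).  BSD is not proved by any of this.

The lead's kernel engine of Kolyvagin's first `2`-descent over `ℚ` at a minimal door (`Theorems/…OneDoorFirstDescentAtTwo.lean`,
p637958; lead report G11 §2) takes the RECIPROCITY input

    hrec : ∀ ℓ, Kol ℓ → ∀ d : V, (∀ v, v ≠ pl ℓ → v ≠ q₀ → d ∈ Loc v) → d ∉ Loc (pl ℓ) →
      ∀ s : V, (∀ v, v ≠ q₀ → s ∈ Loc v) → s ∉ A ℓ → s ∉ A₀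

— «a class `s` RELAXED at the error place `q₀` (Selmer everywhere else) with non-zero localisation at the Kolyvagin prime `ℓ` has
non-zero localisation at `q₀`, as soon as there is a class `d` (Kolyvagin's `c(ℓ)`) Selmer off `{ℓ, q₀}` and NOT Selmer at `ℓ`»:
Poitou–Tate for `(s, d)` leaves the two local terms at `ℓ` and `q₀`; if `s_{q₀} = 0` the `q₀`-term dies, so the cup product at `ℓ`
vanishes, and Tate local duality at `ℓ` (`𝓛_ℓ^⊥ = 𝓛_ℓ`, `#𝓛_ℓ = #E(ℚ_ℓ)[2] = 2`) forces `s_ℓ = 0`.  Route GenusKolyvaginAtTwo's LINE-6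
bricks (seat gk2-p3: `…DualityRat`, `…LocalDualityPerfect`, `…LocalTorsionCount`) prove exactly this for a GENUINE Selmer class `s`
(McCallum's Lemma 5.3 + Prop. 2.2 over `ℚ_ℓ` at `2`, `lemma_5_3_rat_two`); this file is the ONE-ERROR-PLACE variant the engine needs:

* §1 `cupProduct_localization_eq_zero_of_selmer_off_of_localization_eq_zero` — Poitou–Tate, relaxed form (any number field `K`, any
  level `n`): `s` Selmer off a place `v₀`, `d` Selmer off `{v, v₀}`, `s_{v₀} = 0` ⟹ the local cup product of `s_v`, `d_v` vanishes
  (adapted from gk2-p3's `cupProduct_localization_eq_zero_of_selmer_off`: the Poitou–Tate sum over `S = {v, v₀}`);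
* §2 `pow_smul_mem_torsionLocalKer_of_relaxed_of_card_torsion_eq` — the local duality step off `p` by counting, relaxed form (adapted
  from gk2-p3's `pow_smul_mem_torsionLocalKer_of_card_torsion_eq`, verbatim but for §1): `#E(K_v)[p^k] = p^M`, `p^a d` not Selmer at
  `v` ⟹ `p^{M−1−a}·s ∈ torsionLocalKer_v` (error place `v₀ : Place K` arbitrary, `s_{v₀} = 0` as a localisation);
  `pow_smul_mem_torsionLocalKer_of_relaxed_of_mem_torsionLocalKer` — the same for a FINITE error place with `s ∈ torsionLocalKer_{v₀}`;
  primed versions with Poitou–Tate discharged (`K : Type`);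
* §3 `mem_torsionLocalKer_of_relaxed_rat_two_of_card` / `…_rat_two` — over `ℚ` at level `2` (`M = 1`, `a = 0`): `s ∈ torsionLocalKer_v`,
  the count `#E(ℚ_ℓ)[2] = 2` either displayed or DISCHARGED at a Gross–Kolyvagin prime of a curve with `Δ < 0`
  (`ReductionCyclic.natCard_ker_zsmul_adicCompletion_two_pow_eq`);
* §4 `hrec_at_of_card` / `hrec_at` — **the engine's `hrec` in tree currency, contrapositive form**: `Pl = Place ℚ`,
  `Loc w = selmerLocalKer W (Place.Completion w) 2`, `A ℓ = torsionLocalKer` at `v ∣ ℓ`, `A₀ = torsionLocalKer` at the finite error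
  place `v₀ ≠ v`: `s ∉ A ℓ ⟹ s ∉ A₀`.

References: [McCallumLMS1991] §2 Prop. 2.2, §5 Lemma 5.3; [GrossLMS1991] Prop. 8.2, §10; [MilneADT2006] I Cor. 3.4, Lemma 3.3,
Thm. 4.10(b); [MazurRubin2010] Def. 3.1, Prop. 3.3 (the strict/relaxed Selmer groups at one place).
-/

set_option autoImplicit false
-- the Theorems namespace of this sub repeats the summit name by design (D-0017 nested layout)
set_option linter.dupNamespace false

noncomputable section

open scoped Classical Pointwise

universe u

namespace Summit.BirchSwinnertonDyer.BirchSwinnertonDyer.Theorems.RankOneAtTwoOneDoor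

open WeierstrassCurve NumberField IsDedekindDomain Field
open Literature.NumberTheory.EllipticCurves Literature.NumberTheory.GaloisRepresentations
open Literature.NumberTheory.GaloisCohomology
open Literature.NumberTheory.GaloisRepresentations.DiscreteGaloisModule (mu MuCarrier)
open Summit.BirchSwinnertonDyer.Rank1Residual.X11b
open Summit.BirchSwinnertonDyer.BirchSwinnertonDyer.Theorems.GenusExact
open Summit.BirchSwinnertonDyer.BirchSwinnertonDyer.Theorems.GenusExact.FrobeniusCriterion

/-! ## §1 Poitou–Tate, relaxed at one place: `s` Selmer off `v₀`, `d` Selmer off `{v, v₀}`, `s_{v₀} = 0` ⟹ cup product at `v` vanishes -/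

section Global

variable {K : Type u} [Field K] [NumberField K] (W : WeierstrassCurve K) [W.IsElliptic]

-- adapted from Theorems/GenusKolyvaginAtTwoEquivariantKolyvaginExactAtTwoDualityRat.lean §1 (gk2-p3 g12): Poitou–Tate sum over `{v, v₀}`
/-- **The local cup product at `v` vanishes, RELAXED form with one error place `v₀`** (Mazur–Rubin's relaxed Selmer group at `T = {v₀}`
meets McCallum's Prop. 2.2): for `E = W/K` elliptic, any `n ≥ 1`, a Weil pairing `e` on `E[n]`, a finite place `v`, a place `v₀ ≠ v`, and
classes `s, d ∈ H¹(K, E[n])` with `s` Selmer at every place `≠ v₀`, `d` Selmer at every place `∉ {v, v₀}`, and `s_{v₀} = 0`: the cup product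
of `s_v`, `d_v` is `0` in `H²(K_v, μₙ)`.  Every local term off `{v, v₀}` pairs two Kummer classes (isotropy,
`kummerClass_cupProduct_kummerClass_eq_zero_holds`), the term at `v₀` is `(0 ∪ d_{v₀}) = 0`, the Poitou–Tate sum over `S = {v, v₀}` vanishes,
and `inv_v` is injective. [cite: McCallumLMS1991, §2 Prop. 2.2] [cite: MilneADT2006, Ch. I Thm. 4.10(b)] [cite: MazurRubin2010, Def. 3.1] -/
theorem cupProduct_localization_eq_zero_of_selmer_off_of_localization_eq_zero (hPT : poitouTate_sum_localTatePairing_eq_zero K)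
    {n : ℕ} [NeZero n] (e : geomTorsion W n → geomTorsion W n → AlgebraicClosure K)
    (hμ : ∀ S T, e S T ^ n = 1) (hadd₁ : ∀ S₁ S₂ T, e (S₁ + S₂) T = e S₁ T * e S₂ T)
    (hadd₂ : ∀ S T₁ T₂, e S (T₁ + T₂) = e S T₁ * e S T₂) (halt : ∀ T, e T T = 1)
    (hgal : ∀ (σ : absoluteGaloisGroup K) (S T : geomTorsion W n), σ • e S T = e (σ • S) (σ • T))
    (v : HeightOneSpectrum (𝓞 K)) (v₀ : Place K) (hv₀ : v₀ ≠ Sum.inr v) {d s : galH1Torsion W (n : ℤ)}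
    (hd : ∀ w : Place K, w ≠ Sum.inr v → w ≠ v₀ → d ∈ selmerLocalKer W (Place.Completion w) (n : ℤ))
    (hs : ∀ w : Place K, w ≠ v₀ → s ∈ selmerLocalKer W (Place.Completion w) (n : ℤ))
    (hs₀ : galoisCohomology.localization (W.torsionGaloisModule ((n : ℕ) : ℤ)) v₀ 1 s = 0) :
    haveI := absoluteGaloisGroup_compactSpace (v.adicCompletion K)
    ((weilContPairing W n e hμ hadd₁ hadd₂ hgal).restrict
      (absGaloisRestrict K (v.adicCompletion K))).cupProduct
        (galoisCohomology.localization (W.torsionGaloisModule ((n : ℕ) : ℤ)) (Sum.inr v) 1 d)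
        (galoisCohomology.localization (W.torsionGaloisModule ((n : ℕ) : ℤ)) (Sum.inr v) 1 s) = 0 := by
  have _hΓc : ∀ (L : Type u) [Field L], CompactSpace (absoluteGaloisGroup L) :=
    fun L _ => absoluteGaloisGroup_compactSpace L
  -- the family of local invariant maps of the Poitou–Tate predicate at level `n`
  obtain ⟨inv, hperf, hsum⟩ := hPT n
  -- the finite set of places `S = {v, v₀}`
  set S : Finset (Place K) := {Sum.inr v, v₀} with hSdef
  have hmemS : Sum.inr v ∈ S := Finset.mem_insert_self _ _
  have hmemS₀ : v₀ ∈ S := Finset.mem_insert_of_mem (Finset.mem_singleton_self _)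
  -- off `S` both classes satisfy the Kummer condition (isotropy applies)
  have hloc : ∀ {c : galH1Torsion W (n : ℤ)},
      (∀ w : Place K, w ≠ Sum.inr v → w ≠ v₀ → c ∈ selmerLocalKer W (Place.Completion w) (n : ℤ)) →
      ∀ w : Place K, w ∉ S →
        galoisCohomology.localization (W.torsionGaloisModule ((n : ℕ) : ℤ)) w 1 c ∈
          W.kummerSelmerStructure ((n : ℕ) : ℤ) w := by
    intro c hc w hw
    have hwv : w ≠ Sum.inr v := fun h => hw (h ▸ hmemS)
    have hw₀ : w ≠ v₀ := fun h => hw (h ▸ hmemS₀)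
    have hmem : c ∈ selmerLocalKer W (Place.Completion w) ((n : ℕ) : ℤ) := hc w hwv hw₀
    rw [← W.comap_localization_kummerSelmerStructure ((n : ℕ) : ℤ) w] at hmem
    exact hmem
  have hS : ∀ w ∉ S,
      inv w ((weilContPairingLocal W n e hμ hadd₁ hadd₂ hgal w).cupProduct
        (galoisCohomology.localization (W.torsionGaloisModule ((n : ℕ) : ℤ)) w 1 d)
        (galoisCohomology.localization (W.torsionGaloisModule ((n : ℕ) : ℤ)) w 1 s)) = 0 := by
    intro w hw
    have h0 := W.cupProduct_eq_zero_of_mem_kummerSelmerStructure_of_fact n e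
      (by exact_mod_cast NeZero.ne n) w (kummerClass_cupProduct_kummerClass_eq_zero_holds (Place.Completion w))
      hμ hadd₁ hadd₂ halt hgal (hloc hd w hw) (hloc (fun w' _ hw₀ => hs w' hw₀) w hw)
    exact (congrArg (inv w) h0).trans (map_zero _)
  -- Poitou–Tate: the two remaining local terms sum to zero; the one at `v₀` is `(d_{v₀} ∪ 0) = 0`
  have hPTsum := sum_inv_weilCupProduct_localization_eq_zero W n e hμ hadd₁ hadd₂ hgal inv hsum d s S hS
  rw [Finset.sum_pair hv₀.symm] at hPTsum
  have hcup₀ : (weilContPairingLocal W n e hμ hadd₁ hadd₂ hgal v₀).cupProduct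
      (galoisCohomology.localization (W.torsionGaloisModule ((n : ℕ) : ℤ)) v₀ 1 d)
      (galoisCohomology.localization (W.torsionGaloisModule ((n : ℕ) : ℤ)) v₀ 1 s) = 0 := by
    rw [hs₀]; exact map_zero _
  have hterm₀ : inv v₀ ((weilContPairingLocal W n e hμ hadd₁ hadd₂ hgal v₀).cupProduct
      (galoisCohomology.localization (W.torsionGaloisModule ((n : ℕ) : ℤ)) v₀ 1 d)
      (galoisCohomology.localization (W.torsionGaloisModule ((n : ℕ) : ℤ)) v₀ 1 s)) = 0 := by
    rw [hcup₀]; exact map_zero _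
  rw [hterm₀, add_zero] at hPTsum
  exact (hperf v).1.injective (hPTsum.trans (map_zero _).symm)

end Global

/-! ## §2 The local duality step off `p` for a class relaxed at `v₀` with `s_{v₀} = 0` -/

section OffP

variable {K : Type u} [Field K] [NumberField K] (W : WeierstrassCurve K) [W.IsElliptic]

-- adapted from Theorems/GenusKolyvaginAtTwoEquivariantKolyvaginExactAtTwoDualityRat.lean §2 (gk2-p3 g12): `hs` relaxed at `v₀`, §1 replaces the symmetric form
/-- **McCallum's Lemma 5.3 with Prop. 2.2 at a place `v ∤ p`, RELAXED at one other place `v₀`, by COUNTING.**  `E = W/K` elliptic, `p`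
prime, `q = p^k` (`k ≠ 0`), `v` finite with `v ∤ p` and `#E(K_v)[q] = p^M`; `v₀ ≠ v` a place; `s ∈ H¹(K, E[q])` Selmer at every place
`≠ v₀` with `s_{v₀} = 0`; `d ∈ H¹(K, E[q])` Selmer at every place `∉ {v, v₀}` with `p^a·d` NOT Selmer at `v`.  THEN
`p^{M−1−a}·s ∈ torsionLocalKer_v`.  Proof as in the genuine-Selmer case: `U = 𝓛_v` has order `p^M` (Milne I Lemma 3.3), the character
`ψ = (d_v ∪ₑ ·)` kills `s_v` (§1), `p^a ψ ≢ 0` on `U` since `𝓛_v^⊥ = 𝓛_v` (Tate local duality, tree theorem), and the counting lemma.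
[cite: McCallumLMS1991, §5 Lemma 5.3 and §2 Prop. 2.2] [cite: MilneADT2006, Ch. I Cor. 3.4, Lemma 3.3] [cite: MazurRubin2010, Prop. 3.3] -/
theorem pow_smul_mem_torsionLocalKer_of_relaxed_of_card_torsion_eq (hPT : poitouTate_sum_localTatePairing_eq_zero K)
    {p : ℕ} (hp : p.Prime) {k : ℕ} (hk : k ≠ 0) {q : ℕ} (hq : q = p ^ k) [NeZero q]
    (v : HeightOneSpectrum (𝓞 K)) (hpv : (p : 𝓞 K) ∉ v.asIdeal) {M : ℕ}
    (hcard : Nat.card (nsmulAddMonoidHom q :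
        (W.baseChange (v.adicCompletion K)).toAffine.Point →+ _).ker = p ^ M)
    (v₀ : Place K) (hv₀ : v₀ ≠ Sum.inr v)
    {s : galH1Torsion W (q : ℤ)} (hs : ∀ w : Place K, w ≠ v₀ → s ∈ selmerLocalKer W (Place.Completion w) (q : ℤ))
    (hs₀ : galoisCohomology.localization (W.torsionGaloisModule ((q : ℕ) : ℤ)) v₀ 1 s = 0)
    {d : galH1Torsion W (q : ℤ)}
    (hd : ∀ w : Place K, w ≠ Sum.inr v → w ≠ v₀ → d ∈ selmerLocalKer W (Place.Completion w) (q : ℤ))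
    {a : ℕ} (hdv : ((p : ℤ) ^ a) • d ∉ selmerLocalKer W (v.adicCompletion K) (q : ℤ)) :
    ((p : ℤ) ^ (M - 1 - a)) • s ∈ W.torsionLocalKer (v.adicCompletion K) (q : ℤ) := by
  have _hΓc : ∀ (L : Type u) [Field L], CompactSpace (absoluteGaloisGroup L) :=
    fun L _ => absoluteGaloisGroup_compactSpace L
  haveI : Fact p.Prime := ⟨hp⟩
  subst hq
  haveI hK0 : CharZero (v.adicCompletion K) := charZero_adicCompletion v
  have hq2 : 2 ≤ p ^ k := le_trans hp.two_le (Nat.le_self_pow hk p)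
  have hq0 : p ^ k ≠ 0 := NeZero.ne _
  have hqK : ((p ^ k : ℕ) : K) ≠ 0 := Nat.cast_ne_zero.mpr hq0
  -- the Weil pairing on `E[p^k]`
  obtain ⟨e, hμ, hadd₁, hadd₂, halt, hnondeg, hgal⟩ := W.exists_weilPairing_holds (p ^ k) hq2 hqK
  -- local objects at `v`
  set loc := galoisCohomology.localization (W.torsionGaloisModule ((p ^ k : ℕ) : ℤ)) (Sum.inr v) 1
    with hloc
  set U := W.kummerLocalConditionAt ((p ^ k : ℕ) : ℤ) (v.adicCompletion K) with hU
  set cup := ((weilContPairing W (p ^ k) e hμ hadd₁ hadd₂ hgal).restrict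
      (absGaloisRestrict K (v.adicCompletion K))).cupProduct with hcup
  -- `#U = p^M`
  have hUcard : Nat.card U = p ^ M := by
    rw [hU, W.natCard_kummerLocalConditionAt_adicCompletion v hq0,
      LocalDualityOrder.natCard_quotient_span_natCast_eq_one v
        (LocalDualityOrder.natCast_pow_notMem v hpv k), mul_one, hcard]
  -- `x = s_v ∈ U` (`s` is Selmer at `v ≠ v₀`)
  have hsv : s ∈ selmerLocalKer W (v.adicCompletion K) ((p ^ k : ℕ) : ℤ) := hs (Sum.inr v) hv₀.symm
  have hx : loc s ∈ U :=
    mem_kummerLocalConditionAt_res_of_mem_selmerLocalKer W _ _ hsv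
  -- the character `ψ = (d_v ∪ ·)`
  set ψ : galoisCohomology ((W.torsionGaloisModule ((p ^ k : ℕ) : ℤ)).toLocal (Sum.inr v)) 1 →+
      _ := (cup (loc d)).toAddMonoidHom with hψ
  have hψapp : ∀ y, ψ y = cup (loc d) y := fun _ => rfl
  -- `ψ (s_v) = 0`: Poitou–Tate, relaxed form (`d` first)
  have hψx : ψ (loc s) = 0 := by
    rw [hψapp]
    exact cupProduct_localization_eq_zero_of_selmer_off_of_localization_eq_zero W hPT e hμ hadd₁ hadd₂ halt hgal v v₀ hv₀
      hd hs hs₀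
  -- `p^a ψ` does not vanish on `U`: otherwise `(p^a d)_v ∈ U^⊥ = U`, i.e. `p^a d` Selmer at `v`
  have hnot : ¬ ∀ y ∈ U, (p ^ a) • ψ y = 0 := by
    intro hall
    apply hdv
    have hlocd : loc (((p : ℤ) ^ a) • d) = (p ^ a) • loc d := by
      rw [← Nat.cast_pow, natCast_zsmul]; exact map_nsmul _ _ d
    have hmem : loc (((p : ℤ) ^ a) • d) ∈ U := by
      refine (LocalDualityOrder.forall_mem_kummerLocalConditionAt_weilCupProduct_eq_zero_iff_of_not_mem
        v W hk hpv e hμ hadd₁ hadd₂ hgal halt hnondeg _).mp fun y hy => ?_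
      have h := hall y hy
      rw [hψapp] at h
      have h2 : cup ((p ^ a) • loc d) y = (p ^ a) • cup (loc d) y :=
        map_nsmul_apply_left cup (p ^ a) (loc d) y
      rw [hlocd]
      exact h2.trans h
    exact mem_selmerLocalKer_of_mem_kummerLocalConditionAt_res W _ _ hmem
  -- the counting lemma: `p^{M-1-a} · s_v = 0`
  have hkill : (p ^ (M - 1 - a)) • loc s = 0 :=
    pow_smul_eq_zero_of_character_of_card hp hUcard ψ hnot hx hψx
  -- read back as membership in the strict local kernel
  have hlocs : loc (((p : ℤ) ^ (M - 1 - a)) • s) = (p ^ (M - 1 - a)) • loc s := by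
    rw [← Nat.cast_pow, natCast_zsmul]; exact map_nsmul _ _ s
  rw [mem_torsionLocalKer_iff_res_eq_zero W (v.adicCompletion K) hq0]
  exact hlocs.trans hkill

/-- `pow_smul_mem_torsionLocalKer_of_relaxed_of_card_torsion_eq` with Poitou–Tate DISCHARGED (`K : Type`; the tree's
`poitouTate_sum_localTatePairing_eq_zero_holds`). [cite: McCallumLMS1991, §5 Lemma 5.3 and §2 Prop. 2.2] [cite: MilneADT2006, Ch. I Thm. 4.10(b)] -/
theorem pow_smul_mem_torsionLocalKer_of_relaxed_of_card_torsion_eq' {K : Type} [Field K] [NumberField K]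
    (W : WeierstrassCurve K) [W.IsElliptic]
    {p : ℕ} (hp : p.Prime) {k : ℕ} (hk : k ≠ 0) {q : ℕ} (hq : q = p ^ k) [NeZero q]
    (v : HeightOneSpectrum (𝓞 K)) (hpv : (p : 𝓞 K) ∉ v.asIdeal) {M : ℕ}
    (hcard : Nat.card (nsmulAddMonoidHom q :
        (W.baseChange (v.adicCompletion K)).toAffine.Point →+ _).ker = p ^ M)
    (v₀ : Place K) (hv₀ : v₀ ≠ Sum.inr v)
    {s : galH1Torsion W (q : ℤ)} (hs : ∀ w : Place K, w ≠ v₀ → s ∈ selmerLocalKer W (Place.Completion w) (q : ℤ))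
    (hs₀ : galoisCohomology.localization (W.torsionGaloisModule ((q : ℕ) : ℤ)) v₀ 1 s = 0)
    {d : galH1Torsion W (q : ℤ)}
    (hd : ∀ w : Place K, w ≠ Sum.inr v → w ≠ v₀ → d ∈ selmerLocalKer W (Place.Completion w) (q : ℤ))
    {a : ℕ} (hdv : ((p : ℤ) ^ a) • d ∉ selmerLocalKer W (v.adicCompletion K) (q : ℤ)) :
    ((p : ℤ) ^ (M - 1 - a)) • s ∈ W.torsionLocalKer (v.adicCompletion K) (q : ℤ) :=
  pow_smul_mem_torsionLocalKer_of_relaxed_of_card_torsion_eq W (poitouTate_sum_localTatePairing_eq_zero_holds K)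
    hp hk hq v hpv hcard v₀ hv₀ hs hs₀ hd hdv

/-- **Finite error place, membership form.**  As `pow_smul_mem_torsionLocalKer_of_relaxed_of_card_torsion_eq` with `v₀` a FINITE place
`≠ v` and the vanishing `s_{v₀} = 0` given as `s ∈ torsionLocalKer_{v₀}` (`mem_torsionLocalKer_iff_res_eq_zero`).
[cite: McCallumLMS1991, §5 Lemma 5.3 and §2 Prop. 2.2] [cite: MazurRubin2010, Prop. 3.3] -/
theorem pow_smul_mem_torsionLocalKer_of_relaxed_of_mem_torsionLocalKer (hPT : poitouTate_sum_localTatePairing_eq_zero K)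
    {p : ℕ} (hp : p.Prime) {k : ℕ} (hk : k ≠ 0) {q : ℕ} (hq : q = p ^ k) [NeZero q]
    (v : HeightOneSpectrum (𝓞 K)) (hpv : (p : 𝓞 K) ∉ v.asIdeal) {M : ℕ}
    (hcard : Nat.card (nsmulAddMonoidHom q :
        (W.baseChange (v.adicCompletion K)).toAffine.Point →+ _).ker = p ^ M)
    (v₀ : HeightOneSpectrum (𝓞 K)) (hv₀ : v₀ ≠ v)
    {s : galH1Torsion W (q : ℤ)} (hs : ∀ w : Place K, w ≠ Sum.inr v₀ → s ∈ selmerLocalKer W (Place.Completion w) (q : ℤ))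
    (hs₀ : s ∈ W.torsionLocalKer (v₀.adicCompletion K) (q : ℤ))
    {d : galH1Torsion W (q : ℤ)}
    (hd : ∀ w : Place K, w ≠ Sum.inr v → w ≠ Sum.inr v₀ → d ∈ selmerLocalKer W (Place.Completion w) (q : ℤ))
    {a : ℕ} (hdv : ((p : ℤ) ^ a) • d ∉ selmerLocalKer W (v.adicCompletion K) (q : ℤ)) :
    ((p : ℤ) ^ (M - 1 - a)) • s ∈ W.torsionLocalKer (v.adicCompletion K) (q : ℤ) := by
  haveI hK0 : CharZero (v₀.adicCompletion K) := charZero_adicCompletion v₀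
  have hq0 : q ≠ 0 := NeZero.ne _
  have hne : (Sum.inr v₀ : Place K) ≠ Sum.inr v := fun h => hv₀ (Sum.inr_injective h)
  rw [mem_torsionLocalKer_iff_res_eq_zero W (v₀.adicCompletion K) hq0] at hs₀
  exact pow_smul_mem_torsionLocalKer_of_relaxed_of_card_torsion_eq W hPT hp hk hq v hpv hcard (Sum.inr v₀) hne hs hs₀ hd hdv

/-- The same with Poitou–Tate DISCHARGED (`K : Type`; the tree's `poitouTate_sum_localTatePairing_eq_zero_holds`).
[cite: McCallumLMS1991, §5 Lemma 5.3 and §2 Prop. 2.2] [cite: MilneADT2006, Ch. I Thm. 4.10(b)] -/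
theorem pow_smul_mem_torsionLocalKer_of_relaxed_of_mem_torsionLocalKer' {K : Type} [Field K] [NumberField K]
    (W : WeierstrassCurve K) [W.IsElliptic]
    {p : ℕ} (hp : p.Prime) {k : ℕ} (hk : k ≠ 0) {q : ℕ} (hq : q = p ^ k) [NeZero q]
    (v : HeightOneSpectrum (𝓞 K)) (hpv : (p : 𝓞 K) ∉ v.asIdeal) {M : ℕ}
    (hcard : Nat.card (nsmulAddMonoidHom q :
        (W.baseChange (v.adicCompletion K)).toAffine.Point →+ _).ker = p ^ M)
    (v₀ : HeightOneSpectrum (𝓞 K)) (hv₀ : v₀ ≠ v)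
    {s : galH1Torsion W (q : ℤ)} (hs : ∀ w : Place K, w ≠ Sum.inr v₀ → s ∈ selmerLocalKer W (Place.Completion w) (q : ℤ))
    (hs₀ : s ∈ W.torsionLocalKer (v₀.adicCompletion K) (q : ℤ))
    {d : galH1Torsion W (q : ℤ)}
    (hd : ∀ w : Place K, w ≠ Sum.inr v → w ≠ Sum.inr v₀ → d ∈ selmerLocalKer W (Place.Completion w) (q : ℤ))
    {a : ℕ} (hdv : ((p : ℤ) ^ a) • d ∉ selmerLocalKer W (v.adicCompletion K) (q : ℤ)) :
    ((p : ℤ) ^ (M - 1 - a)) • s ∈ W.torsionLocalKer (v.adicCompletion K) (q : ℤ) :=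
  pow_smul_mem_torsionLocalKer_of_relaxed_of_mem_torsionLocalKer W (poitouTate_sum_localTatePairing_eq_zero_holds K)
    hp hk hq v hpv hcard v₀ hv₀ hs hs₀ hd hdv

end OffP

/-! ## §3 Over `ℚ` at level `2` (`M = 1`): a relaxed class dead at the error place dies at every Kolyvagin prime it is tested against -/

section Rat

variable (W : WeierstrassCurve ℚ) [W.IsElliptic]

/-- **Level `2` over `ℚ_ℓ`, from the local count only.**  `E = W/ℚ`, `ℓ` an odd prime below `v` with `#E(ℚ_v)[2] = 2`, `v₀ ≠ v` a
finite place; `s ∈ H¹(ℚ, E[2])` Selmer at every place `≠ v₀` with `s_{v₀} = 0`; `d ∈ H¹(ℚ, E[2])` Selmer at every place `∉ {v, v₀}` and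
NOT Selmer at `v`.  THEN `s ∈ torsionLocalKer_v` (`s_v = 0`).  (The count holds for `E` with `Δ < 0` at a Gross–Kolyvagin prime, and
for `E` of either sign at a «regular» prime — `Frob_ℓ` a transposition on `E[2]` —, so this form serves both corners of the bottom
rung.) [cite: McCallumLMS1991, §5 Lemma 5.3 and §2 Prop. 2.2] [cite: GrossLMS1991, §10] -/
theorem mem_torsionLocalKer_of_relaxed_rat_two_of_card {ℓ : ℕ} [Fact ℓ.Prime] (hℓ2 : ℓ ≠ 2)
    {v : HeightOneSpectrum (𝓞 ℚ)} (hℓv : (ℓ : 𝓞 ℚ) ∈ v.asIdeal)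
    (hcard : Nat.card (nsmulAddMonoidHom 2 : (W.baseChange (v.adicCompletion ℚ)).toAffine.Point →+ _).ker = 2)
    (v₀ : HeightOneSpectrum (𝓞 ℚ)) (hv₀ : v₀ ≠ v)
    {s : galH1Torsion W ((2 : ℕ) : ℤ)}
    (hs : ∀ w : Place ℚ, w ≠ Sum.inr v₀ → s ∈ selmerLocalKer W (Place.Completion w) ((2 : ℕ) : ℤ))
    (hs₀ : s ∈ W.torsionLocalKer (v₀.adicCompletion ℚ) ((2 : ℕ) : ℤ))
    {d : galH1Torsion W ((2 : ℕ) : ℤ)}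
    (hd : ∀ w : Place ℚ, w ≠ Sum.inr v → w ≠ Sum.inr v₀ → d ∈ selmerLocalKer W (Place.Completion w) ((2 : ℕ) : ℤ))
    (hdv : d ∉ selmerLocalKer W (v.adicCompletion ℚ) ((2 : ℕ) : ℤ)) :
    s ∈ W.torsionLocalKer (v.adicCompletion ℚ) ((2 : ℕ) : ℤ) := by
  have h2v : ((2 : ℕ) : 𝓞 ℚ) ∉ v.asIdeal := LocalDualityOrder.two_notMem_of_odd_prime_mem hℓ2 hℓv
  have hdv' : ((2 : ℤ) ^ 0) • d ∉ selmerLocalKer W (v.adicCompletion ℚ) ((2 : ℕ) : ℤ) := by rwa [pow_zero, one_smul]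
  have h := pow_smul_mem_torsionLocalKer_of_relaxed_of_mem_torsionLocalKer' W Nat.prime_two one_ne_zero (q := 2)
    (pow_one 2).symm v h2v (M := 1) (by rw [pow_one]; exact hcard) v₀ hv₀ hs hs₀ hd (a := 0) (by exact_mod_cast hdv')
  simpa using h

/-- **Level `2` over `ℚ_ℓ` at a Gross–Kolyvagin prime of a curve with `Δ < 0`, UNCONDITIONAL**: `E = W/ℚ` globally minimal, `Δ(E) < 0`,
`ℓ` an odd prime of good reduction with `Frob_ℓ ∼ Frob_∞` on the `2`-division tower (`FrobEqFrobInfty W K 2 ℓ`) of depth `≥ 1`, `v ∣ ℓ`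
(so `#E(ℚ_v)[2] = 2`, `ReductionCyclic.natCard_ker_zsmul_adicCompletion_two_pow_eq`); `v₀`, `s`, `d` as in
`mem_torsionLocalKer_of_relaxed_rat_two_of_card`.  THEN `s_v = 0`. [cite: McCallumLMS1991, §5 Lemma 5.3] [cite: GrossLMS1991, Prop. 8.2, §10] -/
theorem mem_torsionLocalKer_of_relaxed_rat_two [W.IsGloballyMinimal] (hΔ : W.Δ < 0) {ℓ : ℕ} [Fact ℓ.Prime] (hℓ2 : ℓ ≠ 2)
    {v : HeightOneSpectrum (𝓞 ℚ)} (hℓv : (ℓ : 𝓞 ℚ) ∈ v.asIdeal) (hgood : W.HasGoodReductionAtPrime ℓ) {K : Type} [Field K]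
    [NumberField K] (hℓK : FrobEqFrobInfty W K 2 ℓ) (h1ℓ : 1 ≤ Zhang2014.kolyvaginIndex W 2 ℓ)
    (v₀ : HeightOneSpectrum (𝓞 ℚ)) (hv₀ : v₀ ≠ v)
    {s : galH1Torsion W ((2 : ℕ) : ℤ)}
    (hs : ∀ w : Place ℚ, w ≠ Sum.inr v₀ → s ∈ selmerLocalKer W (Place.Completion w) ((2 : ℕ) : ℤ))
    (hs₀ : s ∈ W.torsionLocalKer (v₀.adicCompletion ℚ) ((2 : ℕ) : ℤ))
    {d : galH1Torsion W ((2 : ℕ) : ℤ)}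
    (hd : ∀ w : Place ℚ, w ≠ Sum.inr v → w ≠ Sum.inr v₀ → d ∈ selmerLocalKer W (Place.Completion w) ((2 : ℕ) : ℤ))
    (hdv : d ∉ selmerLocalKer W (v.adicCompletion ℚ) ((2 : ℕ) : ℤ)) :
    s ∈ W.torsionLocalKer (v.adicCompletion ℚ) ((2 : ℕ) : ℤ) := by
  refine mem_torsionLocalKer_of_relaxed_rat_two_of_card W hℓ2 hℓv ?_ v₀ hv₀ hs hs₀ hd hdv
  have h := ReductionCyclic.natCard_ker_zsmul_adicCompletion_two_pow_eq W hΔ hℓ2 hgood hℓK hℓv (M := 1) h1ℓ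
  rw [← zsmulAddGroupHom_natCast]
  simpa using h

/-! ## §4 The engine's `hrec` in tree currency (contrapositive form) -/

/-- **`hrec` of `…OneDoorFirstDescentAtTwo.lean` AT A DATUM, from the local count** (`Pl = Place ℚ`, `Loc w = selmerLocalKer` at
`Place.Completion w`, `A ℓ = torsionLocalKer` at `v ∣ ℓ`, `A₀ = torsionLocalKer` at the FINITE error place `v₀ ≠ v`): if `d` is Selmer off
`{v, v₀}` and not Selmer at `v`, then every `s` Selmer off `v₀` with `s_v ≠ 0` has `s_{v₀} ≠ 0`.
[cite: GrossLMS1991, §10 (Claim 10.1)] [cite: McCallumLMS1991, §5 Lemma 5.3] [cite: MazurRubin2010, Prop. 3.3] -/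
theorem hrec_at_of_card {ℓ : ℕ} [Fact ℓ.Prime] (hℓ2 : ℓ ≠ 2)
    {v : HeightOneSpectrum (𝓞 ℚ)} (hℓv : (ℓ : 𝓞 ℚ) ∈ v.asIdeal)
    (hcard : Nat.card (nsmulAddMonoidHom 2 : (W.baseChange (v.adicCompletion ℚ)).toAffine.Point →+ _).ker = 2)
    (v₀ : HeightOneSpectrum (𝓞 ℚ)) (hv₀ : v₀ ≠ v)
    (d : galH1Torsion W ((2 : ℕ) : ℤ))
    (hd : ∀ w : Place ℚ, w ≠ Sum.inr v → w ≠ Sum.inr v₀ → d ∈ selmerLocalKer W (Place.Completion w) ((2 : ℕ) : ℤ))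
    (hdv : d ∉ selmerLocalKer W (v.adicCompletion ℚ) ((2 : ℕ) : ℤ))
    (s : galH1Torsion W ((2 : ℕ) : ℤ))
    (hs : ∀ w : Place ℚ, w ≠ Sum.inr v₀ → s ∈ selmerLocalKer W (Place.Completion w) ((2 : ℕ) : ℤ))
    (hsv : s ∉ W.torsionLocalKer (v.adicCompletion ℚ) ((2 : ℕ) : ℤ)) :
    s ∉ W.torsionLocalKer (v₀.adicCompletion ℚ) ((2 : ℕ) : ℤ) :=
  fun hs₀ => hsv (mem_torsionLocalKer_of_relaxed_rat_two_of_card W hℓ2 hℓv hcard v₀ hv₀ hs hs₀ hd hdv)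

/-- **`hrec` AT A DATUM for a curve with `Δ < 0` at a Gross–Kolyvagin prime, UNCONDITIONAL** (the count discharged by
`ReductionCyclic.natCard_ker_zsmul_adicCompletion_two_pow_eq`): the reciprocity leaf of the bottom rung U₀⁻ in tree currency.
[cite: GrossLMS1991, §10 (Claim 10.1), Prop. 8.2] [cite: McCallumLMS1991, §5 Lemma 5.3] -/
theorem hrec_at [W.IsGloballyMinimal] (hΔ : W.Δ < 0) {ℓ : ℕ} [Fact ℓ.Prime] (hℓ2 : ℓ ≠ 2)
    {v : HeightOneSpectrum (𝓞 ℚ)} (hℓv : (ℓ : 𝓞 ℚ) ∈ v.asIdeal) (hgood : W.HasGoodReductionAtPrime ℓ) {K : Type} [Field K]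
    [NumberField K] (hℓK : FrobEqFrobInfty W K 2 ℓ) (h1ℓ : 1 ≤ Zhang2014.kolyvaginIndex W 2 ℓ)
    (v₀ : HeightOneSpectrum (𝓞 ℚ)) (hv₀ : v₀ ≠ v)
    (d : galH1Torsion W ((2 : ℕ) : ℤ))
    (hd : ∀ w : Place ℚ, w ≠ Sum.inr v → w ≠ Sum.inr v₀ → d ∈ selmerLocalKer W (Place.Completion w) ((2 : ℕ) : ℤ))
    (hdv : d ∉ selmerLocalKer W (v.adicCompletion ℚ) ((2 : ℕ) : ℤ))
    (s : galH1Torsion W ((2 : ℕ) : ℤ))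
    (hs : ∀ w : Place ℚ, w ≠ Sum.inr v₀ → s ∈ selmerLocalKer W (Place.Completion w) ((2 : ℕ) : ℤ))
    (hsv : s ∉ W.torsionLocalKer (v.adicCompletion ℚ) ((2 : ℕ) : ℤ)) :
    s ∉ W.torsionLocalKer (v₀.adicCompletion ℚ) ((2 : ℕ) : ℤ) :=
  fun hs₀ => hsv (mem_torsionLocalKer_of_relaxed_rat_two W hΔ hℓ2 hℓv hgood hℓK h1ℓ v₀ hv₀ hs hs₀ hd hdv)

end Rat

end Summit.BirchSwinnertonDyer.BirchSwinnertonDyer.Theorems.RankOneAtTwoOneDoor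

end
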